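import Literature.AnabelianGeometry.EtaleTheta.Discharge.Sec5Thm57HsepTorsionObstruction
import Literature.AnabelianGeometry.EtaleTheta.SettingModelTateCyclotomes
import Literature.AnabelianGeometry.EtaleTheta.SettingModelTateDoubleUnderline
import Literature.AnabelianGeometry.EtaleTheta.SettingModelCyclotomicCharacterLevelNontrivial
import Literature.AnabelianGeometry.EtaleTheta.SettingModelCyclotomeModPred
import Literature.AnabelianGeometry.EtaleTheta.RootsOfUnityPadicOrders
import HarnessLib

/-!
# [EtTh] §5, Thm. 5.7 (C)-chain: the separation binder `hsep` (exponent `2`) is REFUTED AT THE [EtTh] MODEL OF RECORD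
# `modelχq p i j` for every prime `p ≡ 1 (mod l)` — every étale theta datum, every `X̲̲`, every cyclotome tower, every `η`

S. Mochizuki, *The étale theta function and its Frobenioid-theoretic manifestations*, Publ. RIMS **45** (2009) [EtTh]
(refereed): Cor. 2.8 (i) p. 268 (PDF p. 42), Def. 2.13 pp. 272–273 (PDF pp. 46–47), Def. 2.10 p. 270 (PDF p. 44), §1 p. 238
(PDF p. 12: "`Δ_Θ (≅ Ẑ(1))`") [cite: MochizukiEtTh2009, Cor 2.8 (i) p.268 (PDF p.42); Def 2.13 p.272 (PDF p.46)].
Layer L2 of the abc-iut cell, seat abc-iut-f-123 (gen 8), abc-iut-L2-lead row R983 «HSEP@TATE-DATUM».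

PROOF-ONLY sequel (0 definitions, 0 `Prop` facts) of `Discharge/Sec5Thm57HsepTorsionObstruction` (this seat): its three
hypotheses are DISCHARGED at the stage-2 («Tate shear») model `ThetaSetting.modelχq p i j hj` of abc-iut-L2-t5 / L6-d6 /
L2-t8 (`K = ℚ_p`):
* `hN1` «`Π^tp_X` acts trivially on `Δ_Θ/l·Δ_Θ`» ⟸ `l ∣ p − 1`: the conjugation action on `Δ_Θ = c^Ẑ` IS the cyclotomic
  character (`conjNormal_toTheta_deltaThetaCoordχq`), and `χ_l ≡ 1` on `G_{ℚ_p}` because a primitive `l`-th root of unity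
  lies in `ℚ_p` (`exists_isPrimitiveRoot_padic_of_dvd_pred`, `levelChar_chi_eq_one_of_apply_eq`), so `χ(σ)·t·t⁻¹ ∈ Ẑ^l`
  (`ZHatLevel.level_eq_one_iff_exists_pow`) — `conj_mul_inv_mem_lDeltaTheta_modelχq`;
* `hN2` «the action factors through `aug`» — `conjNormal_toTheta_eq_of_aug_eq_modelχq` (same χ-law);
* `hbad` «some level `M ∈ Es` is divisible by `l^n` with an `l^n`-th root of unity moved by some `σ ∈ G_K = G_{ℚ_p}`» — with
  `n := p`: `l^p ∤ p − 1`, so `G_{ℚ_p}` moves a primitive `l^p`-th root of unity (abc-iut-w5-d213's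
  `exists_galMuN_apply_ne_of_not`), and `Es` is cofinal (`τ.cofinal`) — `exists_moved_root_level_modelχq`.
MAIN: `not_hsep_modelχq` — for `1 < l`, `l ∣ p − 1`, EVERY étale theta datum `E` over `modelχq p i j hj`, EVERY
`C : E.DoubleUnderline l`, EVERY `τ : CyclotomeTower l Es`, every `hC`/`hS` and EVERY compatible family `η` of theta cocycles,
the binder `hsep` of `ThetaEnvTower.etaleTorsion_of_cor219iiiStd` (as carried by the Thm. 5.7 closers `…FinalKnitV6OfMLF*`)
is FALSE.  Hence the G-class binder `hsep` of the closers of record is NOT inhabitable at the Tate datum when `μ_l ⊆ K`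
(print's own regime for `X̲̲ → X`, cf. `modelχq_exists_doubleUnderline_normal`); the exponent-`2l` reshaping is not hit.

HONEST FRAMING. SEMI-SYNTHETIC model (the Tate-sheared χ-twisted root of abc-iut-L2-t5, not the tempered `π₁` of a curve):
the refutation concerns a TYPED junction binder of the cell at a model; refuted-at-a-model / refuted-as-typed ≠ a claim about
[EtTh]; nothing of [EtTh] is asserted or disputed; typed ≠ proved; no side is taken on [IUTchIII] Cor. 3.12.
-/

noncomputable section

namespace Literature.AnabelianGeometry.EtaleTheta.SettingModel

open Literature.AnabelianGeometry.SemiGraphs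

variable (p : ℕ) [Fact p.Prime] (i j : ℤ) (hj : Even j)

/-! ### `hN1` at the model: `Π^tp_X` acts trivially on `Δ_Θ/l·Δ_Θ` when `l ∣ p − 1` -/

/-- **`μ_l ⊆ ℚ_p = K` ⇒ `(g·e·g⁻¹)·e⁻¹ ∈ l·Δ_Θ`** at the stage-2 model, for every `g ∈ Π^tp_X` and `e ∈ Δ_Θ` (`l ∣ p − 1`, `0 < l`):
conjugation acts on `Δ_Θ = c^Ẑ` through the cyclotomic character, which is `≡ 1 (mod l)` on `G_{ℚ_p}`.
[cite: MochizukiEtTh2009, Prop 2.12 (i) p.271 (PDF p.45)] -/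
theorem conj_mul_inv_mem_lDeltaTheta_modelχq {l : ℕ} (hl : 0 < l) (hlp : l ∣ p - 1)
    (g : (ThetaSetting.modelχq p i j hj).PiTemp) (e : (ThetaSetting.modelχq p i j hj).DeltaTheta) :
    ((MulAut.conjNormal ((ThetaSetting.modelχq p i j hj).toTheta g) e * e⁻¹ :
        (ThetaSetting.modelχq p i j hj).DeltaTheta) : (ThetaSetting.modelχq p i j hj).GtpTheta) ∈
      (ThetaSetting.modelχq p i j hj).lDeltaTheta l := by
  obtain ⟨t, rfl⟩ := (bijective_deltaThetaCoordχq p i j).2 e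
  -- move to the model's own spelling of `Δ_Θ = Ker(Δ^Θ ↠ Δ^ell)` (definitionally `D.DeltaTheta`)
  change ((MulAut.conjNormal ((ThetaSetting.modelχq p i j hj).toTheta g) (deltaThetaCoordχq p i j t) *
      (deltaThetaCoordχq p i j t)⁻¹ : (CurveTheta.thetaToEll (curveχq p i j)).ker) :
        CurveTheta.GTheta (curveχq p i j)) ∈ (ThetaSetting.modelχq p i j hj).lDeltaTheta l
  rw [conjNormal_toTheta_deltaThetaCoordχq, ← map_inv, ← map_mul]
  -- `χ_l(aug g) = 1`: a primitive `l`-th root of unity lies in `ℚ_p`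
  have hχ : ZHatLevel.levelChar ⟨l, hl⟩ (chi p ((ThetaSetting.modelχq p i j hj).aug.toMonoidHom g)) = 1 := by
    obtain ⟨ζ, hζ⟩ := exists_isPrimitiveRoot_padic_of_dvd_pred p ⟨l, hl⟩ hlp
    have hζ' : IsPrimitiveRoot (algebraMap ℚ_[p] (PadicAlgCl p) ζ) ((⟨l, hl⟩ : ℕ+) : ℕ) :=
      hζ.map_of_injective (algebraMap ℚ_[p] (PadicAlgCl p)).injective
    exact levelChar_chi_eq_one_of_apply_eq p _ ⟨l, hl⟩ hζ' (AlgEquiv.commutes _ _)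
  -- hence `χ(aug g)·t · t⁻¹` is an `l`-th power in `Ẑ`
  have hlev : ZHatLevel.level ⟨l, hl⟩
      (chi p ((ThetaSetting.modelχq p i j hj).aug.toMonoidHom g) t * t⁻¹) = 1 := by
    apply Multiplicative.toAdd.injective
    rw [map_mul, map_inv, toAdd_mul, toAdd_inv, ZHatLevel.toAdd_level_aut, hχ, one_mul, add_neg_cancel, toAdd_one]
  obtain ⟨s, hs⟩ := (ZHatLevel.level_eq_one_iff_exists_pow ⟨l, hl⟩ _).1 hlev
  refine ⟨deltaThetaCoordχq p i j s, (deltaThetaCoordχq p i j s).2, ?_⟩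
  have hs' : s ^ l = chi p ((ThetaSetting.modelχq p i j hj).aug.toMonoidHom g) t * t⁻¹ := hs
  rw [← hs', map_pow, SubmonoidClass.coe_pow]

/-! ### `hN2` at the model: the conjugation action on `Δ_Θ` factors through `aug` -/

/-- **At the stage-2 model, `g·e·g⁻¹` depends only on `aug g`** (`e ∈ Δ_Θ`): the χ-law `g·c^t·g⁻¹ = c^{χ(aug g)·t}`.
[cite: MochizukiEtTh2009, §1 p.238 (PDF p.12)] -/
theorem conjNormal_toTheta_eq_of_aug_eq_modelχq (g g' : (ThetaSetting.modelχq p i j hj).PiTemp)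
    (e : (ThetaSetting.modelχq p i j hj).DeltaTheta)
    (h : (ThetaSetting.modelχq p i j hj).aug g = (ThetaSetting.modelχq p i j hj).aug g') :
    MulAut.conjNormal ((ThetaSetting.modelχq p i j hj).toTheta g) e =
      MulAut.conjNormal ((ThetaSetting.modelχq p i j hj).toTheta g') e := by
  obtain ⟨t, rfl⟩ := (bijective_deltaThetaCoordχq p i j).2 e
  have h' : (ThetaSetting.modelχq p i j hj).aug.toMonoidHom g = (ThetaSetting.modelχq p i j hj).aug.toMonoidHom g' := h
  change (MulAut.conjNormal ((ThetaSetting.modelχq p i j hj).toTheta g) (deltaThetaCoordχq p i j t) :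
      (CurveTheta.thetaToEll (curveχq p i j)).ker) =
    MulAut.conjNormal ((ThetaSetting.modelχq p i j hj).toTheta g') (deltaThetaCoordχq p i j t)
  rw [conjNormal_toTheta_deltaThetaCoordχq, conjNormal_toTheta_deltaThetaCoordχq, h']

/-! ### `hbad` at the model: a level of `Es` divisible by `l^p`, with a moved `l^p`-th root of unity -/

/-- **A bad level EXISTS at the stage-2 model** (`1 < l`, `l ∣ p − 1`, any cofinal `Es`): `l^p ∤ p − 1`, so some
`σ ∈ G_{ℚ_p} = G_K` moves a primitive `l^p`-th root of unity (`exists_galMuN_apply_ne_of_not`); transport it to a level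
`M ∈ Es` with `l^p ∣ M` (`τ.cofinal`). [cite: MochizukiEtTh2009, Def 2.10 p.270 (PDF p.44)] -/
theorem exists_moved_root_level_modelχq {l : ℕ} (hl : 1 < l) (hlp : l ∣ p - 1) {Es : Set ℕ+}
    (τ : (ThetaSetting.modelχq p i j hj).CyclotomeTower l Es) :
    ∃ (M : Es) (n : ℕ), l ^ n ∣ ((M : ℕ+) : ℕ) ∧ ∃ σ : GQp p, σ ∈ (ThetaSetting.modelχq p i j hj).GK ∧
      ∃ u : MuN p M, u ^ (l ^ n) = 1 ∧ galMuN p M σ u ≠ u := by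
  have hp := (Fact.out : p.Prime)
  have hp1 : 0 < p - 1 := by have := hp.two_le; omega
  -- `p ≠ 2` (else `l ∣ 1`)
  have hp2 : p ≠ 2 := by
    rintro rfl
    have : l ∣ 1 := hlp
    have := Nat.le_of_dvd Nat.one_pos this
    omega
  -- `l^p ∤ p − 1` (`l^p ≥ 2^p > p`)
  have hnot : ¬ (l ^ p ∣ p - 1) := by
    intro h
    have h1 := Nat.le_of_dvd hp1 h
    have h2 : 2 ^ p ≤ l ^ p := Nat.pow_le_pow_left hl p
    have h3 : p < 2 ^ p := Nat.lt_two_pow_self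
    omega
  set N : ℕ+ := ⟨l ^ p, pow_pos (by omega) p⟩ with hN
  obtain ⟨σ, u₀, hσu₀⟩ := exists_galMuN_apply_ne_of_not p N (by
    rintro (h | ⟨h2, -⟩)
    · exact hnot h
    · exact hp2 h2)
  obtain ⟨M, hM, hNM⟩ := τ.cofinal N
  have hdvd : l ^ p ∣ ((M : ℕ+) : ℕ) := PNat.dvd_iff.1 hNM
  have hu₀N : ((u₀ : (PadicAlgCl p)ˣ)) ^ (l ^ p) = 1 := (mem_rootsOfUnity _ _).1 u₀.2
  refine ⟨⟨M, hM⟩, p, hdvd, σ, by rw [GK_modelχq]; trivial,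
    ⟨(u₀ : (PadicAlgCl p)ˣ), rootsOfUnity_le_of_dvd hdvd u₀.2⟩, ?_, fun h => hσu₀ ?_⟩
  · exact Subtype.ext (by rw [SubmonoidClass.mk_pow]; exact hu₀N)
  · apply Subtype.ext
    apply Units.ext
    have h' := congrArg (fun v : MuN p M => (((v : (PadicAlgCl p)ˣ)) : PadicAlgCl p)) h
    simpa only [galMuN_apply_coe] using h'

/-! ### Main theorem: `hsep` is refuted at the Tate datum for `l ∣ p − 1` -/

/-- **`hsep` (exponent `2`) is FALSE at the [EtTh] model of record `modelχq p i j hj` whenever `1 < l`, `l ∣ p − 1`** — for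
EVERY étale theta datum `E`, EVERY `C : E.DoubleUnderline l` (`X̲̲`), EVERY compatible system of cyclotome identifications
`τ : CyclotomeTower l Es`, all `hC`/`hS`, and EVERY compatible family `η` of theta cocycles of `C.thetaEnvTower τ hC hS`: the
cross-level separation binder of `ThetaEnvTower.etaleTorsion_of_cor219iiiStd` (verbatim the `hsep` of the Thm. 5.7 closers
`…FinalKnitV6OfMLF*`) is refuted by the `μ_l`-ambiguity witness of `Sec5Thm57HsepTorsionObstruction` (Cor. 2.8 (i)).
[cite: MochizukiEtTh2009, Cor 2.8 (i) p.268 (PDF p.42); Def 2.13 p.272 (PDF p.46)] -/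
theorem not_hsep_modelχq {l : ℕ} (hl : 1 < l) (hlp : l ∣ p - 1)
    {E : (ThetaSetting.modelχq p i j hj).EtaleThetaData} (C : E.DoubleUnderline l) {Es : Set ℕ+}
    (τ : (ThetaSetting.modelχq p i j hj).CyclotomeTower l Es)
    (hC : (ThetaSetting.modelχq p i j hj).Compat) (hS : (ThetaSetting.modelχq p i j hj).Sec2Hyps)
    (η : ∀ M : Es, (C.thetaEnvTower τ hC hS).PiYdd → (C.thetaEnvTower τ hC hS).mu M)
    (hη : ∀ M, η M ∈ (C.thetaEnvTower τ hC hS).thetaCocycles M)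
    (hηc : ∀ (M M' : Es) (hd : (M : ℕ+) ∣ M'), (C.thetaEnvTower τ hC hS).red M M' hd ∘ η M' = η M) :
    ¬ (∀ η' : ∀ M : Es, (C.thetaEnvTower τ hC hS).PiYdd → (C.thetaEnvTower τ hC hS).mu M,
      (∀ M, η' M ∈ (C.thetaEnvTower τ hC hS).thetaCocycles M) →
      (∀ (M M' : Es) (hd : (M : ℕ+) ∣ M'), (C.thetaEnvTower τ hC hS).red M M' hd ∘ η' M' = η' M) →
      (∀ (M : Es) (k k' : (C.thetaEnvTower τ hC hS).PiYdd),
        (C.thetaEnvTower τ hC hS).aug k = (C.thetaEnvTower τ hC hS).aug k' →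
          η' M k * (η M k)⁻¹ = η' M k' * (η M k')⁻¹) →
      ∀ M : Es, ∃ d : (C.thetaEnvTower τ hC hS).mu M, ∀ k : (C.thetaEnvTower τ hC hS).PiYdd,
        (η' M k * (η M k)⁻¹) ^ 2 =
          CycEnvelope.coboundary ((C.thetaEnvTower τ hC hS).aug.comp (C.thetaEnvTower τ hC hS).PiYdd.subtype)
            ((C.thetaEnvTower τ hC hS).chi M) d k) :=
  C.not_hsep_of_trivial_action_mod_l τ hC hS
    (conj_mul_inv_mem_lDeltaTheta_modelχq p i j hj (by omega) hlp)
    (conjNormal_toTheta_eq_of_aug_eq_modelχq p i j hj)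
    (exists_moved_root_level_modelχq p i j hj hl hlp τ) η hη hηc

/-- **Joint form**: at the stage-2 model with `1 < l ∣ p − 1`, for every étale theta datum, `X̲̲`, tower and COMPATIBLE family
`η`, there EXISTS a compatible family `η'` of theta cocycles with `aug`-inflated ratio `η'/η` and a level `M ∈ Es` at which
`(η' M k · (η M k)⁻¹)²` is NOT a coboundary — the negation of `hsep` unfolded (same content as `not_hsep_modelχq`).
[cite: MochizukiEtTh2009, Cor 2.8 (i) p.268 (PDF p.42); Def 2.13 p.272 (PDF p.46)] -/
theorem exists_compatible_family_sq_not_coboundary_modelχq {l : ℕ} (hl : 1 < l) (hlp : l ∣ p - 1)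
    {E : (ThetaSetting.modelχq p i j hj).EtaleThetaData} (C : E.DoubleUnderline l) {Es : Set ℕ+}
    (τ : (ThetaSetting.modelχq p i j hj).CyclotomeTower l Es)
    (hC : (ThetaSetting.modelχq p i j hj).Compat) (hS : (ThetaSetting.modelχq p i j hj).Sec2Hyps)
    (η : ∀ M : Es, (C.thetaEnvTower τ hC hS).PiYdd → (C.thetaEnvTower τ hC hS).mu M)
    (hη : ∀ M, η M ∈ (C.thetaEnvTower τ hC hS).thetaCocycles M)
    (hηc : ∀ (M M' : Es) (hd : (M : ℕ+) ∣ M'), (C.thetaEnvTower τ hC hS).red M M' hd ∘ η M' = η M) :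
    ∃ η' : ∀ M : Es, (C.thetaEnvTower τ hC hS).PiYdd → (C.thetaEnvTower τ hC hS).mu M,
      (∀ M, η' M ∈ (C.thetaEnvTower τ hC hS).thetaCocycles M) ∧
      (∀ (M M' : Es) (hd : (M : ℕ+) ∣ M'), (C.thetaEnvTower τ hC hS).red M M' hd ∘ η' M' = η' M) ∧
      (∀ (M : Es) (k k' : (C.thetaEnvTower τ hC hS).PiYdd),
        (C.thetaEnvTower τ hC hS).aug k = (C.thetaEnvTower τ hC hS).aug k' →
          η' M k * (η M k)⁻¹ = η' M k' * (η M k')⁻¹) ∧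
      ∃ M : Es, ∀ d : (C.thetaEnvTower τ hC hS).mu M, ∃ k : (C.thetaEnvTower τ hC hS).PiYdd,
        (η' M k * (η M k)⁻¹) ^ 2 ≠
          CycEnvelope.coboundary ((C.thetaEnvTower τ hC hS).aug.comp (C.thetaEnvTower τ hC hS).PiYdd.subtype)
            ((C.thetaEnvTower τ hC hS).chi M) d k := by
  have h := not_hsep_modelχq p i j hj hl hlp C τ hC hS η hη hηc
  simp only [not_forall, not_exists] at h
  obtain ⟨η', hη', hη'c, hinfl, M, hM⟩ := h
  exact ⟨η', hη', hη'c, hinfl, M, fun d => (hM d).imp fun k hk => hk⟩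

/-- **Joint non-vacuous form**: at the stage-2 model with `1 < l ∣ p − 1`, for every étale theta datum, every `X̲̲`, every
tower and all `hC`/`hS`, the binders `η`/`hη`/`hηc` of the Thm. 5.7 closers ARE inhabited (`exists_compatible_thetaCocycles`)
and NO such inhabitant admits `hsep` — the binder set `{η, hη, hηc, hsep}` is jointly unsatisfiable at the datum because of
`hsep` alone. [cite: MochizukiEtTh2009, Cor 2.8 (i) p.268 (PDF p.42); Def 2.13 p.272 (PDF p.46)] -/
theorem exists_compatible_family_not_hsep_modelχq {l : ℕ} (hl : 1 < l) (hlp : l ∣ p - 1)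
    {E : (ThetaSetting.modelχq p i j hj).EtaleThetaData} (C : E.DoubleUnderline l) {Es : Set ℕ+}
    (τ : (ThetaSetting.modelχq p i j hj).CyclotomeTower l Es)
    (hC : (ThetaSetting.modelχq p i j hj).Compat) (hS : (ThetaSetting.modelχq p i j hj).Sec2Hyps) :
    ∃ η : ∀ M : Es, (C.thetaEnvTower τ hC hS).PiYdd → (C.thetaEnvTower τ hC hS).mu M,
      (∀ M, η M ∈ (C.thetaEnvTower τ hC hS).thetaCocycles M) ∧
      (∀ (M M' : Es) (hd : (M : ℕ+) ∣ M'), (C.thetaEnvTower τ hC hS).red M M' hd ∘ η M' = η M) ∧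
      ¬ (∀ η' : ∀ M : Es, (C.thetaEnvTower τ hC hS).PiYdd → (C.thetaEnvTower τ hC hS).mu M,
        (∀ M, η' M ∈ (C.thetaEnvTower τ hC hS).thetaCocycles M) →
        (∀ (M M' : Es) (hd : (M : ℕ+) ∣ M'), (C.thetaEnvTower τ hC hS).red M M' hd ∘ η' M' = η' M) →
        (∀ (M : Es) (k k' : (C.thetaEnvTower τ hC hS).PiYdd),
          (C.thetaEnvTower τ hC hS).aug k = (C.thetaEnvTower τ hC hS).aug k' →
            η' M k * (η M k)⁻¹ = η' M k' * (η M k')⁻¹) →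
        ∀ M : Es, ∃ d : (C.thetaEnvTower τ hC hS).mu M, ∀ k : (C.thetaEnvTower τ hC hS).PiYdd,
          (η' M k * (η M k)⁻¹) ^ 2 =
            CycEnvelope.coboundary ((C.thetaEnvTower τ hC hS).aug.comp (C.thetaEnvTower τ hC hS).PiYdd.subtype)
              ((C.thetaEnvTower τ hC hS).chi M) d k) := by
  obtain ⟨η, hη, hηc⟩ := C.exists_compatible_thetaCocycles τ hC hS
  exact ⟨η, hη, hηc, not_hsep_modelχq p i j hj hl hlp C τ hC hS η hη hηc⟩

end Literature.AnabelianGeometry.EtaleTheta.SettingModel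

end
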